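import Mathlib
import Summits.MatrixMultiplication.MatrixMultiplication.Theorems.LieRankDesigns.Negative.AdditiveBox
import Summits.MatrixMultiplication.MatrixMultiplication.Theorems.LieRankDesigns.Negative.RadicalBoxes

/-!
# Heisenberg boxes are dark at level one (negative lemma, crux `LieRankDesigns`, 7614; also 14079 / 14080)

The first concrete instance of the additive-box filter (`Negative/AdditiveBox.lean`) at level `k = 1`, the level of line
`fixed-rank-universality-gl2-level-one` (crux 7614) and of crux `LevelOneGL2Designs` (14080): if the tested set through `1`
of a level-one identity test contains the Heisenberg box `{1 + t₁E_{ab} + t₂E_{bc} + t₃E_{ac}}` (`a ≠ b ≠ c`; as a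
SET this is the product of the aligned full root cosets `(1 + 𝔽_pE_{ab} + 𝔽_pE_{ac})·(1 + 𝔽_pE_{bc})`, the upper unitriangular
`U₃` of the `(a,b,c)` block), then no level-one function is `1` at `1` and `0` on the rest
(`no_levelOne_idTest_of_heisenbergBox`).  Reason: the functional `λ = (1, 1, 0)` on the box (induced by `Λ = E_{ba} + E_{cb}`)
is induced by no matrix of rank `≤ 1` — `M_{ba} = M_{cb} = 1`, `M_{ca} = 0` make rows `b, c` and columns `a, b` of `M` a
unitriangular `2 × 2` block.  By bi-invariance of `F_1` the same holds for any two-sided translate of the box, e.g. inside the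
quadruple-product set of a `RankSep 1` triple two of whose sets contain aligned full root cosets: level-one designs must thin
INSIDE radical cosets.  Sorry-free; standard axioms.
-/

set_option linter.dupNamespace false

noncomputable section

open scoped BigOperators
open Matrix

namespace Summit.MatrixMultiplication.MatrixMultiplication.Theorems.LieRankDesigns.Negative

variable {p n : ℕ} [Fact p.Prime]

/-- **Heisenberg boxes are dark at level one.**  Indices `a ≠ b ≠ c` (for `a = c` the hypothesis `hu` is itself
unsatisfiable at `t₂ = -1`, so nothing is lost), `S ⊆ GL_n(𝔽_p)` a set containing units `u(t)` with
matrices `1 + t₀E_{ab} + t₁E_{bc} + t₂E_{ac}` for all `t ∈ 𝔽_p^3`: no coefficient table of Fourier rank `≤ 1` gives `f(1) = 1` and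
`f = 0` on `S ∖ 1`. [this file, from `no_idTest_of_additive_box_subset`] -/
theorem no_levelOne_idTest_of_heisenbergBox (a b c : Fin n) (hab : a ≠ b) (hbc : b ≠ c)
    (S : Set (GLm p n)) (u : (Fin 3 → ZMod p) → GLm p n)
    (hu : ∀ t, (u t : Mat p n) = 1 + ∑ i : Fin 3, t i • ![Matrix.single a b (1 : ZMod p), Matrix.single b c 1, Matrix.single a c 1] i)
    (hS : ∀ t, u t ∈ S)
    (coef : Mat p n → ℂ) (hc : RankSupp 1 coef) (h1 : fourierFn coef 1 = 1)
    (h0 : ∀ s ∈ S, s ≠ 1 → fourierFn coef s = 0) : False := by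
  classical
  refine no_idTest_of_additive_box_subset 1 _ u hu S hS (Matrix.single b a 1 + Matrix.single c b 1) (fun M hM => ?_)
    coef hc h1 h0
  -- the three trace conditions: `M_{ba} = 1`, `M_{cb} = 1`, `M_{ca} = 0`
  have htr : ∀ (i j : Fin n), Matrix.trace (M * Matrix.single i j (1 : ZMod p)) = M j i := by
    intro i j
    rw [Matrix.trace_mul_comm, Matrix.trace_single_mul, one_smul]
  have hΛab : Matrix.trace ((Matrix.single b a 1 + Matrix.single c b 1) * Matrix.single a b (1 : ZMod p)) = 1 := by
    rw [Matrix.add_mul, Matrix.trace_add, Matrix.single_mul_single_same,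
      Matrix.single_mul_single_of_ne (h := hab.symm), Matrix.trace_zero, add_zero, mul_one, Matrix.trace_single_eq_same]
  have hΛbc : Matrix.trace ((Matrix.single b a 1 + Matrix.single c b 1) * Matrix.single b c (1 : ZMod p)) = 1 := by
    rw [Matrix.add_mul, Matrix.trace_add, Matrix.single_mul_single_of_ne (h := hab), Matrix.single_mul_single_same,
      Matrix.trace_zero, zero_add, mul_one, Matrix.trace_single_eq_same]
  have hΛac : Matrix.trace ((Matrix.single b a 1 + Matrix.single c b 1) * Matrix.single a c (1 : ZMod p)) = 0 := by
    rw [Matrix.add_mul, Matrix.trace_add, Matrix.single_mul_single_same,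
      Matrix.single_mul_single_of_ne (h := hab.symm), Matrix.trace_zero, add_zero, mul_one,
      Matrix.trace_single_eq_of_ne (h := hbc)]
  have h0' := hM 0
  have h1' := hM 1
  have h2' := hM 2
  simp only [Matrix.sub_mul, Matrix.trace_sub, Matrix.cons_val_zero, Matrix.cons_val_one, Matrix.head_cons,
    Matrix.cons_val_two, Matrix.tail_cons, htr, hΛab, hΛbc, hΛac, sub_eq_zero] at h0' h1' h2'
  -- h0' : M b a = 1, h1' : M c b = 1, h2' : M c a = 0 ⇒ rows (b, c) × columns (a, b) unitriangular ⇒ rk M ≥ 2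
  let x : Fin 2 → (Fin n → ZMod p) := ![Pi.single b 1 - M b b • Pi.single c 1, Pi.single c 1]
  let y : Fin 2 → (Fin n → ZMod p) := ![Pi.single a 1, Pi.single b 1]
  refine lt_rank_of_biorthogonal 1 M x y fun i j => ?_
  fin_cases i <;> fin_cases j <;>
    simp [x, y, sub_dotProduct, smul_dotProduct, single_dotProduct, Matrix.col_apply, h0', h1', h2']

end Summit.MatrixMultiplication.MatrixMultiplication.Theorems.LieRankDesigns.Negative

end
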